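import Literature.Analysis.UnboundedOperators.LinearizedBoltzmannSymmetryProofs
import Literature.MathematicalPhysics.KineticTheory.HardSphereEntranceProofs
import Mathlib.MeasureTheory.Constructions.HaarToSphere
import HarnessLib

/-!
# The linearised hard-sphere operator: row bounds for the weighted gain and loss kernels

Sibling proof file of `LinearizedBoltzmann.lean` (towards the discharge of
`exists_isSelfAdjoint_hasCore`, CIP 1994 §7.2 Thm 7.2.1: the linearised hard-sphere operator
`L = K - ν` has a self-adjoint realisation on `L²(M dv)` with the temperate-growth functions as a
core). The classical route (Hilbert 1912, Grad 1963, Cercignani–Illner–Pulvirenti 1994 §7.2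
Thms 7.2.2–7.2.4) bounds the gain operator `K₂` on `L²` through its explicit (Carleman) kernel
(2.16), in dimension `3`. Here we prepare a dimension-free proof of `K ∈ B(L²(M dv))` by a
*weighted Cauchy–Schwarz inequality with detailed-balance weights*: for the three bilinear forms
`∫∫∫ B M M_* h(v) g(u)`, `u ∈ {v_*, v', v_*'}`, `B = ((v - v_*)·ω)₊`, one has
`|∫ B M M_* h(v) g(u)| ≤ (∫ B M M_* w h(v)²)^{1/2} (∫ B M M_* w g(v)²)^{1/2}` for a weight `w` with
`w ∘ T = 1/w` under the measure-preserving involution `T` exchanging `v` and `u`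
(`LinearizedBoltzmannGainForms`), so that everything reduces to the *row bounds*
`sup_v ∫∫ B(v, v_*, ω) M(v_*) w dω dv_* < ∞` proved in this file:

* `exists_lossWeight_rowBound` — `w = (1 + |v_*|)²/(1 + |v|)²` (loss term `g(v_*)`);
* `exists_gainWeightSnd_rowBound` — `w = (M(v)/M(v_*'))^{1/2} = e^{(|v_*|² - |v'|²)/4}`
  (gain term `g(v_*')`), which rests on the **cap lemma**
  `exists_lintegral_sphere_cap_le`: in dimension `d ≥ 2`,
  `sup_v ∫_{S^{d-1}} |v·ω| e^{-(|v|² - (v·ω)²)/4} dω < ∞` (the integrand is `~|v|` on a polar cap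
  of angular radius `~1/|v|`, of measure `~|v|^{1-d}`), proved by polar coordinates
  (`KineticTheory.lintegral_eq_lintegral_sphereMeasure_polar`) applied to
  `x ↦ |v·x| e^{|v·x| - |x|²}` (radial lower bound on the cap, completion of the square and
  translation invariance for the upper bound);
* `exists_gainWeightFst_rowBound` — `w = (M(v)/M(v'))^{1/2} = e^{(|v_*|² - |v_*'|²)/4}`
  (gain term `g(v')`; only `|a| e^{-a²/4} ≤ 1` is needed).

The pointwise inputs are the identities `|v'|² = |v|² - (v·ω)² + (v_*·ω)²`,
`|v_*'|² = |v_*|² - (v_*·ω)² + (v·ω)²` (`norm_sq_collide_fst_eq`, `norm_sq_collide_snd_eq`) and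
`((v - v_*)·ω)₊ ≤ |v·ω| + |v_*|` (`hardSphereKernel_le_abs_inner_add_norm`).

## References

* C. Cercignani, R. Illner, M. Pulvirenti, *The Mathematical Theory of Dilute Gases*, Springer
  (1994), §7.2, Thm 7.2.1 p. 197 and Thms 7.2.2–7.2.4 pp. 197–199 (`K ∈ B(L²)` for hard spheres,
  `d = 3`, via Grad's kernel estimates (2.16)–(2.17)).
* H. Grad, *Asymptotic theory of the Boltzmann equation II*, Rarefied Gas Dynamics I (1963)
  26–59 (the splitting `L = -ν + K`).
-/

open MeasureTheory Metric Real Set Filter Topology ProbabilityTheory Module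
open scoped InnerProductSpace ENNReal

namespace Literature.Analysis.UnboundedOperators

noncomputable section

open Literature.MathematicalPhysics.KineticTheory (collide sphereMeasure hardSphereKernel
  real_inner_self_sphere lintegral_eq_lintegral_sphereMeasure_polar)
open Literature.Analysis.FluidPDE

/-! ### Pointwise identities for the collision law -/

section Pointwise

variable {E : Type*} [NormedAddCommGroup E] [InnerProductSpace ℝ E]

/-- `|v'|² = |v|² - (v·ω)² + (v_*·ω)²`: the collision replaces the `ω`-component of `v` by that of
`v_*` and keeps the orthogonal component (CIP 1994 §3.1 (3.1.2)). [cite: CIP1994, §3.1 (3.1.2)] -/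
theorem norm_sq_collide_fst_eq (ω : sphere (0 : E) 1) (v w : E) :
    ‖(collide ω (v, w)).1‖ ^ 2 = ‖v‖ ^ 2 - ⟪v, (ω : E)⟫_ℝ ^ 2 + ⟪w, (ω : E)⟫_ℝ ^ 2 := by
  have h := real_inner_self_sphere ω
  simp only [collide, ← real_inner_self_eq_norm_sq, inner_sub_left, inner_sub_right,
    inner_smul_left, inner_smul_right, h, real_inner_comm (ω : E), RCLike.conj_to_real]
  ring

/-- `|v_*'|² = |v_*|² - (v_*·ω)² + (v·ω)²` (CIP 1994 §3.1 (3.1.2)). [cite: CIP1994, §3.1 (3.1.2)] -/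
theorem norm_sq_collide_snd_eq (ω : sphere (0 : E) 1) (v w : E) :
    ‖(collide ω (v, w)).2‖ ^ 2 = ‖w‖ ^ 2 - ⟪w, (ω : E)⟫_ℝ ^ 2 + ⟪v, (ω : E)⟫_ℝ ^ 2 := by
  have h := real_inner_self_sphere ω
  simp only [collide, ← real_inner_self_eq_norm_sq, inner_sub_right,
    inner_add_left, inner_add_right, inner_smul_left, inner_smul_right, h,
    real_inner_comm (ω : E), RCLike.conj_to_real]
  ring

/-- `((v - v_*)·ω)₊ ≤ |v·ω| + |v_*|`. [folklore] -/
theorem hardSphereKernel_le_abs_inner_add_norm (v w : E) (ω : sphere (0 : E) 1) :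
    hardSphereKernel (v, w) ω ≤ |⟪v, (ω : E)⟫_ℝ| + ‖w‖ := by
  have h1 : |⟪w, (ω : E)⟫_ℝ| ≤ ‖w‖ := by
    have := abs_real_inner_le_norm w (ω : E)
    rwa [norm_eq_of_mem_sphere ω, mul_one] at this
  have h2 : ⟪v - w, (ω : E)⟫_ℝ ≤ |⟪v, (ω : E)⟫_ℝ| + ‖w‖ := by
    rw [inner_sub_left]
    linarith [le_abs_self ⟪v, (ω : E)⟫_ℝ, neg_abs_le ⟪w, (ω : E)⟫_ℝ]
  exact max_le h2 (by positivity)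

/-- `|v·ω| ≤ |v|` for a unit vector `ω`. [folklore] -/
theorem abs_inner_sphere_le (v : E) (ω : sphere (0 : E) 1) : |⟪v, (ω : E)⟫_ℝ| ≤ ‖v‖ := by
  have := abs_real_inner_le_norm v (ω : E)
  rwa [norm_eq_of_mem_sphere ω, mul_one] at this

/-- `|t| e^{-t²/4} ≤ 1` (`|t| ≤ 1 + t²/4 ≤ e^{t²/4}`). [folklore] -/
theorem abs_mul_exp_neg_sq_div_four_le_one (t : ℝ) : |t| * exp (-(t ^ 2) / 4) ≤ 1 := by
  have h1 : |t| ≤ 1 + t ^ 2 / 4 := by nlinarith [sq_abs t, sq_nonneg (|t| - 2), abs_nonneg t]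
  have h2 : 1 + t ^ 2 / 4 ≤ exp (t ^ 2 / 4) := by linarith [add_one_le_exp (t ^ 2 / 4)]
  have h3 : exp (-(t ^ 2) / 4) = (exp (t ^ 2 / 4))⁻¹ := by rw [← Real.exp_neg]; congr 1; ring
  rw [h3, ← div_eq_mul_inv, div_le_one (exp_pos _)]
  exact h1.trans h2

end Pointwise

/-! ### The cap lemma -/

section Cap

variable {E : Type*} [NormedAddCommGroup E] [InnerProductSpace ℝ E] [FiniteDimensional ℝ E]
  [MeasurableSpace E] [BorelSpace E]

/-- Radial lower bound on the cap: for `b > 0`,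
`(b/2)^{m+1} b e^{b²/4 - 1} ≤ ∫_0^∞ r^m (r b e^{r b - r²}) dr` (restrict to `r ∈ [b/2, b/2 + 1]`,
where `r b - r² = b²/4 - (r - b/2)² ≥ b²/4 - 1`). [folklore] -/
theorem ofReal_radial_le_lintegral {b : ℝ} (hb : 0 < b) (m : ℕ) :
    ENNReal.ofReal ((b / 2) ^ (m + 1) * b * exp (b ^ 2 / 4 - 1)) ≤
      ∫⁻ r in Ioi (0 : ℝ), ENNReal.ofReal (r ^ m) *
        ENNReal.ofReal (r * b * exp (r * b - r ^ 2)) := by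
  have hsub : Icc (b / 2) (b / 2 + 1) ⊆ Ioi (0 : ℝ) := fun r hr =>
    lt_of_lt_of_le (by positivity) hr.1
  calc ENNReal.ofReal ((b / 2) ^ (m + 1) * b * exp (b ^ 2 / 4 - 1))
      = ∫⁻ _ in Icc (b / 2) (b / 2 + 1),
          ENNReal.ofReal ((b / 2) ^ (m + 1) * b * exp (b ^ 2 / 4 - 1)) := by
        rw [setLIntegral_const, Real.volume_Icc, add_sub_cancel_left, ENNReal.ofReal_one, mul_one]
    _ ≤ ∫⁻ r in Icc (b / 2) (b / 2 + 1), ENNReal.ofReal (r ^ m) *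
          ENNReal.ofReal (r * b * exp (r * b - r ^ 2)) := by
        refine setLIntegral_mono' measurableSet_Icc fun r hr => ?_
        have hr0 : b / 2 ≤ r := hr.1
        have hr1 : r ≤ b / 2 + 1 := hr.2
        have hrpos : 0 < r := lt_of_lt_of_le (by positivity) hr0
        rw [← ENNReal.ofReal_mul (by positivity)]
        refine ENNReal.ofReal_le_ofReal ?_
        have hexp : exp (b ^ 2 / 4 - 1) ≤ exp (r * b - r ^ 2) := by
          refine exp_le_exp.2 ?_
          nlinarith [mul_nonneg (sub_nonneg.2 hr0) (by linarith : (0 : ℝ) ≤ b / 2 + 1 - r)]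
        have hpow : (b / 2) ^ m ≤ r ^ m := pow_le_pow_left₀ (by positivity) hr0 m
        calc (b / 2) ^ (m + 1) * b * exp (b ^ 2 / 4 - 1)
            = (b / 2) ^ m * ((b / 2) * b * exp (b ^ 2 / 4 - 1)) := by rw [pow_succ]; ring
          _ ≤ r ^ m * (r * b * exp (r * b - r ^ 2)) := by
              refine mul_le_mul hpow ?_ (by positivity) (by positivity)
              exact mul_le_mul (mul_le_mul_of_nonneg_right hr0 hb.le) hexp (by positivity)
                (by positivity)
    _ ≤ _ := lintegral_mono_set hsub

/-- Completion of the square and translation: `∫ |v·x| e^{v·x - |x|²} dx ≤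
e^{|v|²/4} (|v| ∫ |y| e^{-|y|²} dy + (|v|²/2) ∫ e^{-|y|²} dy)` (as `ℝ≥0∞`-integrals), since
`v·x - |x|² = |v|²/4 - |x - v/2|²` and `|v·(y + v/2)| ≤ |v| |y| + |v|²/2`. [folklore] -/
theorem lintegral_abs_inner_mul_exp_le (v : E) :
    ∫⁻ x, ENNReal.ofReal (|⟪v, x⟫_ℝ| * exp (⟪v, x⟫_ℝ - ‖x‖ ^ 2)) ≤
      ENNReal.ofReal (exp (‖v‖ ^ 2 / 4)) *
        (ENNReal.ofReal ‖v‖ * (∫⁻ y : E, ENNReal.ofReal (‖y‖ * exp (-‖y‖ ^ 2))) +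
          ENNReal.ofReal (‖v‖ ^ 2 / 2) * (∫⁻ y : E, ENNReal.ofReal (exp (-‖y‖ ^ 2)))) := by
  have hsq : ∀ x : E, ⟪v, x⟫_ℝ - ‖x‖ ^ 2 = ‖v‖ ^ 2 / 4 - ‖x - (1 / 2 : ℝ) • v‖ ^ 2 := by
    intro x
    rw [← real_inner_self_eq_norm_sq, ← real_inner_self_eq_norm_sq,
      ← real_inner_self_eq_norm_sq (x - _)]
    simp only [inner_sub_left, inner_sub_right, inner_smul_left, inner_smul_right,
      real_inner_comm v x, RCLike.conj_to_real]
    ring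
  set f : E → ℝ≥0∞ := fun y => ENNReal.ofReal (|⟪v, y + (1 / 2 : ℝ) • v⟫_ℝ| *
    (exp (‖v‖ ^ 2 / 4) * exp (-‖y‖ ^ 2))) with hf
  have hfx : ∀ x : E, ENNReal.ofReal (|⟪v, x⟫_ℝ| * exp (⟪v, x⟫_ℝ - ‖x‖ ^ 2)) =
      f (x - (1 / 2 : ℝ) • v) := by
    intro x
    simp only [hf, sub_add_cancel, hsq x, sub_eq_add_neg (‖v‖ ^ 2 / 4), Real.exp_add]
  simp_rw [hfx]
  rw [lintegral_sub_right_eq_self f ((1 / 2 : ℝ) • v)]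
  -- pointwise bound on `f`
  have hfle : ∀ y : E, f y ≤ ENNReal.ofReal (exp (‖v‖ ^ 2 / 4)) *
      (ENNReal.ofReal ‖v‖ * ENNReal.ofReal (‖y‖ * exp (-‖y‖ ^ 2)) +
        ENNReal.ofReal (‖v‖ ^ 2 / 2) * ENNReal.ofReal (exp (-‖y‖ ^ 2))) := by
    intro y
    rw [hf, ← ENNReal.ofReal_mul (norm_nonneg _), ← ENNReal.ofReal_mul (by positivity),
      ← ENNReal.ofReal_add (by positivity) (by positivity), ← ENNReal.ofReal_mul (by positivity)]
    refine ENNReal.ofReal_le_ofReal ?_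
    have hin : |⟪v, y + (1 / 2 : ℝ) • v⟫_ℝ| ≤ ‖v‖ * ‖y‖ + ‖v‖ ^ 2 / 2 := by
      rw [inner_add_right, inner_smul_right, real_inner_self_eq_norm_sq]
      refine (abs_add_le _ _).trans (add_le_add (abs_real_inner_le_norm v y) ?_)
      rw [abs_of_nonneg (by positivity)]
      linarith
    have h0 : 0 ≤ exp (‖v‖ ^ 2 / 4) * exp (-‖y‖ ^ 2) := by positivity
    calc |⟪v, y + (1 / 2 : ℝ) • v⟫_ℝ| * (exp (‖v‖ ^ 2 / 4) * exp (-‖y‖ ^ 2))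
        ≤ (‖v‖ * ‖y‖ + ‖v‖ ^ 2 / 2) * (exp (‖v‖ ^ 2 / 4) * exp (-‖y‖ ^ 2)) :=
          mul_le_mul_of_nonneg_right hin h0
      _ = exp (‖v‖ ^ 2 / 4) * (‖v‖ * (‖y‖ * exp (-‖y‖ ^ 2)) + ‖v‖ ^ 2 / 2 * exp (-‖y‖ ^ 2)) := by
          ring
  have hm1 : Measurable fun y : E => ENNReal.ofReal (‖y‖ * exp (-‖y‖ ^ 2)) :=
    (by fun_prop : Continuous fun y : E => ‖y‖ * exp (-‖y‖ ^ 2)).measurable.ennreal_ofReal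
  have hm0 : Measurable fun y : E => ENNReal.ofReal (exp (-‖y‖ ^ 2)) :=
    (by fun_prop : Continuous fun y : E => exp (-‖y‖ ^ 2)).measurable.ennreal_ofReal
  calc ∫⁻ y, f y ≤ ∫⁻ y, ENNReal.ofReal (exp (‖v‖ ^ 2 / 4)) *
        (ENNReal.ofReal ‖v‖ * ENNReal.ofReal (‖y‖ * exp (-‖y‖ ^ 2)) +
          ENNReal.ofReal (‖v‖ ^ 2 / 2) * ENNReal.ofReal (exp (-‖y‖ ^ 2))) := lintegral_mono hfle
    _ = _ := by
        rw [lintegral_const_mul' _ _ ENNReal.ofReal_ne_top, lintegral_add_left (hm1.const_mul _),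
          lintegral_const_mul' _ _ ENNReal.ofReal_ne_top,
          lintegral_const_mul' _ _ ENNReal.ofReal_ne_top]

/-- The Gaussian constants `∫ e^{-|y|²} dy` and `∫ |y| e^{-|y|²} dy` are finite. [folklore] -/
theorem lintegral_exp_neg_norm_sq_lt_top :
    ∫⁻ y : E, ENNReal.ofReal (exp (-‖y‖ ^ 2)) < ∞ := by
  have h := (integrable_exp_neg_mul_sq_norm (E := E) one_pos).hasFiniteIntegral
  rw [hasFiniteIntegral_iff_enorm] at h
  refine lt_of_le_of_lt (lintegral_mono fun y => ?_) h
  rw [neg_mul, one_mul]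
  exact Real.ofReal_le_enorm _

/-- See `lintegral_exp_neg_norm_sq_lt_top`. [folklore] -/
theorem lintegral_norm_mul_exp_neg_norm_sq_lt_top :
    ∫⁻ y : E, ENNReal.ofReal (‖y‖ * exp (-‖y‖ ^ 2)) < ∞ := by
  have h := (integrable_one_add_norm_mul_exp (E := E) (β := 2) two_pos).hasFiniteIntegral
  rw [hasFiniteIntegral_iff_enorm] at h
  refine lt_of_le_of_lt (lintegral_mono fun y => ?_) h
  refine (ENNReal.ofReal_le_ofReal ?_).trans (Real.ofReal_le_enorm _)
  have : exp (-(2 / 2) * ‖y‖ ^ 2) = exp (-‖y‖ ^ 2) := by norm_num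
  rw [this]
  nlinarith [exp_pos (-‖y‖ ^ 2), norm_nonneg y]

/-- **Cap lemma.** In dimension `d ≥ 2` the sphere integrals
`J(v) = ∫_{S^{d-1}} |v·ω| e^{-(|v|² - (v·ω)²)/4} dσ(ω)` are bounded uniformly in `v ∈ E`. Off the
polar caps `{(v·ω)² > |v|²/2}` the integrand is `≤ |a| e^{-a²/4} ≤ 1` (`a = v·ω`); on the caps,
polar coordinates (`∫ F dx = ∫_S ∫_0^∞ r^{d-1} F(rω) dr dσ`) for `F(x) = |v·x| e^{|v·x| - |x|²}`
give `|a| e^{a²/4} ≤ e (2/|a|)^d ∫_0^∞ r^{d-1} F(rω) dr ≤ e (2√2/|v|)^d ∫_0^∞ r^{d-1} F(rω) dr`,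
while `∫ F ≤ 2 e^{|v|²/4} (|v| I₁ + |v|² I₀/2)` by completing the square; the total is
`≤ σ(S) + 2e (2√2)^d (I₁ + I₀)` for `|v| ≥ 1` (this is where `d ≥ 2` enters), and `≤ σ(S)` for
`|v| ≤ 1`. [folklore] -/
theorem exists_lintegral_sphere_cap_le (hE : 2 ≤ finrank ℝ E) :
    ∃ C : ℝ≥0∞, C ≠ ∞ ∧ ∀ v : E,
      ∫⁻ ω : sphere (0 : E) 1, ENNReal.ofReal (|⟪v, (ω : E)⟫_ℝ| *
        exp (-(‖v‖ ^ 2 - ⟪v, (ω : E)⟫_ℝ ^ 2) / 4)) ∂sphereMeasure ≤ C := by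
  haveI := isFiniteMeasure_sphereMeasure (E := E)
  obtain ⟨m, hm⟩ : ∃ m : ℕ, finrank ℝ E = m + 1 := ⟨finrank ℝ E - 1, by omega⟩
  have hm1 : 1 ≤ m := by omega
  set I₀ : ℝ≥0∞ := ∫⁻ y : E, ENNReal.ofReal (exp (-‖y‖ ^ 2)) with hI₀
  set I₁ : ℝ≥0∞ := ∫⁻ y : E, ENNReal.ofReal (‖y‖ * exp (-‖y‖ ^ 2)) with hI₁
  have hI₀t : I₀ < ∞ := lintegral_exp_neg_norm_sq_lt_top
  have hI₁t : I₁ < ∞ := lintegral_norm_mul_exp_neg_norm_sq_lt_top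
  set S : ℝ≥0∞ := (sphereMeasure : Measure (sphere (0 : E) 1)) univ with hS
  have hSt : S < ∞ := measure_lt_top _ _
  set A : ℝ := exp 1 * (2 * Real.sqrt 2) ^ (m + 1) with hA
  have hA0 : 0 ≤ A := by positivity
  refine ⟨S + ENNReal.ofReal (2 * A) * (I₁ + I₀), ?_, fun v => ?_⟩
  · exact ENNReal.add_ne_top.2 ⟨hSt.ne, ENNReal.mul_ne_top ENNReal.ofReal_ne_top
      (ENNReal.add_ne_top.2 ⟨hI₁t.ne, hI₀t.ne⟩)⟩
  -- the integrand and its trivial bound off the cap / for small `v`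
  have hterm1 : ∀ ω : sphere (0 : E) 1, ⟪v, (ω : E)⟫_ℝ ^ 2 ≤ ‖v‖ ^ 2 / 2 →
      |⟪v, (ω : E)⟫_ℝ| * exp (-(‖v‖ ^ 2 - ⟪v, (ω : E)⟫_ℝ ^ 2) / 4) ≤ 1 := by
    intro ω hω
    refine le_trans ?_ (abs_mul_exp_neg_sq_div_four_le_one ⟪v, (ω : E)⟫_ℝ)
    refine mul_le_mul_of_nonneg_left (exp_le_exp.2 ?_) (abs_nonneg _)
    linarith
  by_cases hv : ‖v‖ ≤ 1
  · -- small `v`: the integrand is `≤ 1`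
    calc ∫⁻ ω : sphere (0 : E) 1, ENNReal.ofReal (|⟪v, (ω : E)⟫_ℝ| *
          exp (-(‖v‖ ^ 2 - ⟪v, (ω : E)⟫_ℝ ^ 2) / 4)) ∂sphereMeasure
        ≤ ∫⁻ _ : sphere (0 : E) 1, 1 ∂sphereMeasure := by
          refine lintegral_mono fun ω => ?_
          rw [← ENNReal.ofReal_one]
          refine ENNReal.ofReal_le_ofReal ?_
          have ha := abs_inner_sphere_le v ω
          have hsq : ⟪v, (ω : E)⟫_ℝ ^ 2 ≤ ‖v‖ ^ 2 := by
            rw [← sq_abs]; exact pow_le_pow_left₀ (abs_nonneg _) ha 2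
          calc |⟪v, (ω : E)⟫_ℝ| * exp (-(‖v‖ ^ 2 - ⟪v, (ω : E)⟫_ℝ ^ 2) / 4)
              ≤ 1 * 1 := by
                refine mul_le_mul (ha.trans hv) ?_ (by positivity) zero_le_one
                rw [exp_le_one_iff]
                linarith
            _ = 1 := one_mul _
      _ = S := by rw [lintegral_const, one_mul]
      _ ≤ S + ENNReal.ofReal (2 * A) * (I₁ + I₀) := le_self_add
  -- large `v`
  push Not at hv
  have hv0 : 0 < ‖v‖ := one_pos.trans hv
  set F : E → ℝ≥0∞ := fun x => ENNReal.ofReal (|⟪v, x⟫_ℝ| * exp (|⟪v, x⟫_ℝ| - ‖x‖ ^ 2))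
    with hF
  have hFm : Measurable F :=
    (by fun_prop : Continuous fun x : E => |⟪v, x⟫_ℝ| * exp (|⟪v, x⟫_ℝ| - ‖x‖ ^ 2)).measurable
      |>.ennreal_ofReal
  set R : sphere (0 : E) 1 → ℝ≥0∞ := fun ω =>
    ∫⁻ r in Ioi (0 : ℝ), ENNReal.ofReal (r ^ m) * F (r • (ω : E)) with hR
  set κ : ℝ := exp (-‖v‖ ^ 2 / 4) * exp 1 * (2 * Real.sqrt 2 / ‖v‖) ^ (m + 1) with hκ
  have hκ0 : 0 ≤ κ := by positivity
  -- pointwise bound: `term ≤ 1 + κ R(ω)`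
  have hpt : ∀ ω : sphere (0 : E) 1,
      ENNReal.ofReal (|⟪v, (ω : E)⟫_ℝ| * exp (-(‖v‖ ^ 2 - ⟪v, (ω : E)⟫_ℝ ^ 2) / 4)) ≤
        1 + ENNReal.ofReal κ * R ω := by
    intro ω
    set a : ℝ := ⟪v, (ω : E)⟫_ℝ with ha
    by_cases hcap : a ^ 2 ≤ ‖v‖ ^ 2 / 2
    · calc ENNReal.ofReal (|a| * exp (-(‖v‖ ^ 2 - a ^ 2) / 4)) ≤ ENNReal.ofReal 1 :=
            ENNReal.ofReal_le_ofReal (hterm1 ω hcap)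
        _ = 1 := ENNReal.ofReal_one
        _ ≤ 1 + ENNReal.ofReal κ * R ω := le_self_add
    · push Not at hcap
      set b : ℝ := |a| with hb
      have hb2 : b ^ 2 = a ^ 2 := sq_abs a
      have hbpos : 0 < b := by
        rw [hb, abs_pos]
        intro h0
        rw [h0, show (0 : ℝ) ^ 2 = 0 by ring] at hcap
        linarith [sq_nonneg ‖v‖]
      -- the radial integral along `ω` is the one of `ofReal_radial_le_lintegral`
      have hRω : R ω = ∫⁻ r in Ioi (0 : ℝ), ENNReal.ofReal (r ^ m) *
          ENNReal.ofReal (r * b * exp (r * b - r ^ 2)) := by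
        refine setLIntegral_congr_fun measurableSet_Ioi fun r hr => ?_
        have hr : 0 < r := hr
        simp only [hF, inner_smul_right, norm_smul, Real.norm_eq_abs, abs_of_pos hr,
          norm_eq_of_mem_sphere ω, mul_one, abs_mul, ← ha, ← hb]
      have hrad := ofReal_radial_le_lintegral hbpos m
      rw [← hRω] at hrad
      -- `term = e^{-|v|²/4} e (2/b)^d · [(b/2)^d b e^{b²/4 - 1}]`
      have hid : |a| * exp (-(‖v‖ ^ 2 - a ^ 2) / 4) =
          (exp (-‖v‖ ^ 2 / 4) * exp 1 * (2 / b) ^ (m + 1)) *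
            ((b / 2) ^ (m + 1) * b * exp (b ^ 2 / 4 - 1)) := by
        have he : exp (-(‖v‖ ^ 2 - a ^ 2) / 4) =
            exp (-‖v‖ ^ 2 / 4) * exp 1 * exp (b ^ 2 / 4 - 1) := by
          rw [← Real.exp_add, ← Real.exp_add, ← hb2]; congr 1; ring
        have hp : (2 / b) ^ (m + 1) * (b / 2) ^ (m + 1) = 1 := by
          rw [← mul_pow, div_mul_div_comm, mul_comm 2 b, div_self (by positivity), one_pow]
        rw [he, ← hb]
        calc b * (exp (-‖v‖ ^ 2 / 4) * exp 1 * exp (b ^ 2 / 4 - 1))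
            = exp (-‖v‖ ^ 2 / 4) * exp 1 * ((2 / b) ^ (m + 1) * (b / 2) ^ (m + 1)) *
                (b * exp (b ^ 2 / 4 - 1)) := by rw [hp]; ring
          _ = _ := by ring
      -- `(2/b)^d ≤ (2√2/|v|)^d` on the cap
      have hcmp : 2 / b ≤ 2 * Real.sqrt 2 / ‖v‖ := by
        rw [div_le_div_iff₀ hbpos hv0]
        have h2 : ‖v‖ ^ 2 ≤ (Real.sqrt 2 * b) ^ 2 := by
          rw [mul_pow, Real.sq_sqrt (by norm_num : (0 : ℝ) ≤ 2), hb2]; linarith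
        have h3 : ‖v‖ ≤ Real.sqrt 2 * b := by
          nlinarith [Real.sqrt_nonneg 2, mul_nonneg (Real.sqrt_nonneg 2) hbpos.le, norm_nonneg v]
        nlinarith
      have hcoef : exp (-‖v‖ ^ 2 / 4) * exp 1 * (2 / b) ^ (m + 1) ≤ κ := by
        rw [hκ]
        exact mul_le_mul_of_nonneg_left (pow_le_pow_left₀ (by positivity) hcmp _)
          (by positivity)
      calc ENNReal.ofReal (|a| * exp (-(‖v‖ ^ 2 - a ^ 2) / 4))
          = ENNReal.ofReal (exp (-‖v‖ ^ 2 / 4) * exp 1 * (2 / b) ^ (m + 1)) *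
              ENNReal.ofReal ((b / 2) ^ (m + 1) * b * exp (b ^ 2 / 4 - 1)) := by
            rw [hid, ENNReal.ofReal_mul (by positivity)]
        _ ≤ ENNReal.ofReal κ * R ω :=
            mul_le_mul' (ENNReal.ofReal_le_ofReal hcoef) hrad
        _ ≤ 1 + ENNReal.ofReal κ * R ω := le_add_self
  -- the volume integral of `F`: `e^{|t|} ≤ e^t + e^{-t}` and the completed square, twice
  have hFle : ∫⁻ x, F x ≤ 2 * (ENNReal.ofReal (exp (‖v‖ ^ 2 / 4)) *
      (ENNReal.ofReal ‖v‖ * I₁ + ENNReal.ofReal (‖v‖ ^ 2 / 2) * I₀)) := by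
    have hF2 : ∀ x : E, F x ≤ ENNReal.ofReal (|⟪v, x⟫_ℝ| * exp (⟪v, x⟫_ℝ - ‖x‖ ^ 2)) +
        ENNReal.ofReal (|⟪-v, x⟫_ℝ| * exp (⟪-v, x⟫_ℝ - ‖x‖ ^ 2)) := by
      intro x
      rw [hF, ← ENNReal.ofReal_add (by positivity) (by positivity)]
      refine ENNReal.ofReal_le_ofReal ?_
      rw [inner_neg_left, abs_neg, ← mul_add]
      refine mul_le_mul_of_nonneg_left ?_ (abs_nonneg _)
      rw [Real.exp_sub, Real.exp_sub, Real.exp_sub, ← add_div]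
      gcongr
      exact Real.exp_abs_le _
    have hm2 : Measurable fun x : E =>
        ENNReal.ofReal (|⟪v, x⟫_ℝ| * exp (⟪v, x⟫_ℝ - ‖x‖ ^ 2)) :=
      (by fun_prop : Continuous fun x : E => |⟪v, x⟫_ℝ| * exp (⟪v, x⟫_ℝ - ‖x‖ ^ 2)).measurable
        |>.ennreal_ofReal
    calc ∫⁻ x, F x ≤ ∫⁻ x, (ENNReal.ofReal (|⟪v, x⟫_ℝ| * exp (⟪v, x⟫_ℝ - ‖x‖ ^ 2)) +
          ENNReal.ofReal (|⟪-v, x⟫_ℝ| * exp (⟪-v, x⟫_ℝ - ‖x‖ ^ 2))) := lintegral_mono hF2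
      _ ≤ _ := by
          rw [lintegral_add_left hm2, two_mul]
          have h1 := lintegral_abs_inner_mul_exp_le v
          have h2 := lintegral_abs_inner_mul_exp_le (-v)
          rw [norm_neg] at h2
          rw [← hI₁, ← hI₀] at h1 h2
          exact add_le_add h1 h2
  -- the real constants: `κ e^{|v|²/4} = e (2√2/|v|)^d` and `|v|^{1-d}, |v|^{2-d}/2 ≤ 1`
  have hκe : κ * exp (‖v‖ ^ 2 / 4) = exp 1 * (2 * Real.sqrt 2 / ‖v‖) ^ (m + 1) := by
    have hee : exp (-‖v‖ ^ 2 / 4) * exp (‖v‖ ^ 2 / 4) = 1 := by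
      rw [← Real.exp_add, show -‖v‖ ^ 2 / 4 + ‖v‖ ^ 2 / 4 = 0 by ring, Real.exp_zero]
    calc κ * exp (‖v‖ ^ 2 / 4)
        = (exp (-‖v‖ ^ 2 / 4) * exp (‖v‖ ^ 2 / 4)) *
            (exp 1 * (2 * Real.sqrt 2 / ‖v‖) ^ (m + 1)) := by rw [hκ]; ring
      _ = _ := by rw [hee, one_mul]
  have hq1 : (2 * Real.sqrt 2 / ‖v‖) ^ (m + 1) * ‖v‖ ≤ (2 * Real.sqrt 2) ^ (m + 1) := by
    rw [div_pow, div_mul_eq_mul_div, div_le_iff₀ (by positivity)]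
    exact mul_le_mul_of_nonneg_left (le_self_pow₀ hv.le (by omega)) (by positivity)
  have hq2 : (2 * Real.sqrt 2 / ‖v‖) ^ (m + 1) * (‖v‖ ^ 2 / 2) ≤ (2 * Real.sqrt 2) ^ (m + 1) := by
    rw [div_pow, div_mul_eq_mul_div, div_le_iff₀ (by positivity)]
    have : ‖v‖ ^ 2 / 2 ≤ ‖v‖ ^ (m + 1) :=
      (half_le_self (by positivity)).trans (pow_le_pow_right₀ hv.le (by omega))
    exact mul_le_mul_of_nonneg_left this (by positivity)
  have hk1 : κ * 2 * exp (‖v‖ ^ 2 / 4) * ‖v‖ ≤ 2 * A := by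
    calc κ * 2 * exp (‖v‖ ^ 2 / 4) * ‖v‖ = 2 * exp 1 * ((2 * Real.sqrt 2 / ‖v‖) ^ (m + 1) * ‖v‖) := by
          rw [show κ * 2 * exp (‖v‖ ^ 2 / 4) = 2 * (κ * exp (‖v‖ ^ 2 / 4)) by ring, hκe]; ring
      _ ≤ 2 * exp 1 * (2 * Real.sqrt 2) ^ (m + 1) :=
          mul_le_mul_of_nonneg_left hq1 (by positivity)
      _ = 2 * A := by rw [hA]; ring
  have hk2 : κ * 2 * exp (‖v‖ ^ 2 / 4) * (‖v‖ ^ 2 / 2) ≤ 2 * A := by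
    calc κ * 2 * exp (‖v‖ ^ 2 / 4) * (‖v‖ ^ 2 / 2)
        = 2 * exp 1 * ((2 * Real.sqrt 2 / ‖v‖) ^ (m + 1) * (‖v‖ ^ 2 / 2)) := by
          rw [show κ * 2 * exp (‖v‖ ^ 2 / 4) = 2 * (κ * exp (‖v‖ ^ 2 / 4)) by ring, hκe]; ring
      _ ≤ 2 * exp 1 * (2 * Real.sqrt 2) ^ (m + 1) :=
          mul_le_mul_of_nonneg_left hq2 (by positivity)
      _ = 2 * A := by rw [hA]; ring
  have hc1 : ENNReal.ofReal κ * 2 * ENNReal.ofReal (exp (‖v‖ ^ 2 / 4)) * ENNReal.ofReal ‖v‖ ≤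
      ENNReal.ofReal (2 * A) := by
    rw [← ENNReal.ofReal_ofNat 2, ← ENNReal.ofReal_mul hκ0, ← ENNReal.ofReal_mul (by positivity),
      ← ENNReal.ofReal_mul (by positivity)]
    exact ENNReal.ofReal_le_ofReal hk1
  have hc2 : ENNReal.ofReal κ * 2 * ENNReal.ofReal (exp (‖v‖ ^ 2 / 4)) *
      ENNReal.ofReal (‖v‖ ^ 2 / 2) ≤ ENNReal.ofReal (2 * A) := by
    rw [← ENNReal.ofReal_ofNat 2, ← ENNReal.ofReal_mul hκ0, ← ENNReal.ofReal_mul (by positivity),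
      ← ENNReal.ofReal_mul (by positivity)]
    exact ENNReal.ofReal_le_ofReal hk2
  -- integrate the pointwise bound and use polar coordinates
  calc ∫⁻ ω : sphere (0 : E) 1, ENNReal.ofReal (|⟪v, (ω : E)⟫_ℝ| *
        exp (-(‖v‖ ^ 2 - ⟪v, (ω : E)⟫_ℝ ^ 2) / 4)) ∂sphereMeasure
      ≤ ∫⁻ ω : sphere (0 : E) 1, (1 + ENNReal.ofReal κ * R ω) ∂sphereMeasure := lintegral_mono hpt
    _ = S + ENNReal.ofReal κ * ∫⁻ x, F x := by
        rw [lintegral_add_left measurable_const, lintegral_const, one_mul,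
          lintegral_const_mul' _ _ ENNReal.ofReal_ne_top,
          lintegral_eq_lintegral_sphereMeasure_polar hm hFm]
    _ ≤ S + ENNReal.ofReal κ * (2 * (ENNReal.ofReal (exp (‖v‖ ^ 2 / 4)) *
          (ENNReal.ofReal ‖v‖ * I₁ + ENNReal.ofReal (‖v‖ ^ 2 / 2) * I₀))) := by
        gcongr
    _ = S + ((ENNReal.ofReal κ * 2 * ENNReal.ofReal (exp (‖v‖ ^ 2 / 4)) * ENNReal.ofReal ‖v‖) * I₁ +
          (ENNReal.ofReal κ * 2 * ENNReal.ofReal (exp (‖v‖ ^ 2 / 4)) *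
            ENNReal.ofReal (‖v‖ ^ 2 / 2)) * I₀) := by ring
    _ ≤ S + (ENNReal.ofReal (2 * A) * I₁ + ENNReal.ofReal (2 * A) * I₀) := by
        gcongr
    _ = S + ENNReal.ofReal (2 * A) * (I₁ + I₀) := by rw [mul_add]

end Cap

/-! ### Row bounds for the three detailed-balance weights -/

section RowBounds

variable {E : Type*} [NormedAddCommGroup E] [InnerProductSpace ℝ E] [FiniteDimensional ℝ E]
  [MeasurableSpace E] [BorelSpace E]

omit [FiniteDimensional ℝ E] [MeasurableSpace E] [BorelSpace E] in
/-- `M(w) e^{|w|²/4} = (2π)^{-d/2} e^{-|w|²/4}`. [folklore] -/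
theorem globalMaxwellian_mul_exp_norm_sq_div_four (w : E) :
    globalMaxwellian w * exp (‖w‖ ^ 2 / 4) =
      (2 * π) ^ (-(finrank ℝ E : ℝ) / 2) * exp (-‖w‖ ^ 2 / 4) := by
  simp only [globalMaxwellian]
  rw [mul_assoc, ← Real.exp_add]
  congr 2
  ring

/-- `∫ c e^{-|w|²/4} dw < ∞`. [folklore] -/
theorem lintegral_const_mul_exp_neg_norm_sq_div_four_lt_top (c : ℝ) :
    ∫⁻ w : E, ENNReal.ofReal (c * exp (-‖w‖ ^ 2 / 4)) < ∞ := by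
  have h := ((integrable_exp_neg_mul_sq_norm (E := E) (b := 1 / 4) (by norm_num)).const_mul
    c).hasFiniteIntegral
  rw [hasFiniteIntegral_iff_enorm] at h
  refine lt_of_le_of_lt (lintegral_mono fun w => ?_) h
  rw [show -(1 / 4 : ℝ) * ‖w‖ ^ 2 = -‖w‖ ^ 2 / 4 by ring]
  exact Real.ofReal_le_enorm _

/-- `∫ c |w| e^{-|w|²/4} dw < ∞` for `c ≥ 0`. [folklore] -/
theorem lintegral_const_mul_norm_mul_exp_neg_norm_sq_div_four_lt_top {c : ℝ} (hc : 0 ≤ c) :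
    ∫⁻ w : E, ENNReal.ofReal (c * (‖w‖ * exp (-‖w‖ ^ 2 / 4))) < ∞ := by
  have h := ((integrable_one_add_norm_mul_exp (E := E) (β := 1 / 2) (by norm_num)).const_mul
    c).hasFiniteIntegral
  rw [hasFiniteIntegral_iff_enorm] at h
  refine lt_of_le_of_lt (lintegral_mono fun w => ?_) h
  rw [show -(1 / 2 / 2 : ℝ) * ‖w‖ ^ 2 = -‖w‖ ^ 2 / 4 by ring]
  refine (ENNReal.ofReal_le_ofReal ?_).trans (Real.ofReal_le_enorm _)
  refine mul_le_mul_of_nonneg_left ?_ hc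
  nlinarith [exp_pos (-‖w‖ ^ 2 / 4), norm_nonneg w]

/-- **Row bound for the loss weight** `w = (1 + |v_*|)²/(1 + |v|)²`:
`sup_v ∫∫ ((v - v_*)·ω)₊ M(v_*) (1 + |v_*|)²/(1 + |v|)² dω dv_* < ∞` (the integrand is
`≤ (1 + |v_*|)³ M(v_*)`). [folklore] -/
theorem exists_lossWeight_rowBound :
    ∃ C : ℝ≥0∞, C ≠ ∞ ∧ ∀ v : E,
      ∫⁻ w, ∫⁻ ω, ENNReal.ofReal (hardSphereKernel (v, w) ω * globalMaxwellian w *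
        ((1 + ‖w‖) / (1 + ‖v‖)) ^ 2) ∂sphereMeasure ≤ C := by
  haveI := isFiniteMeasure_sphereMeasure (E := E)
  set S : ℝ≥0∞ := (sphereMeasure : Measure (sphere (0 : E) 1)) univ with hS
  have hSt : S < ∞ := measure_lt_top _ _
  set m₃ : ℝ≥0∞ := ∫⁻ w : E, ENNReal.ofReal ((1 + ‖w‖) ^ 3 * globalMaxwellian w) with hm₃
  have hm₃t : m₃ < ∞ := by
    have h := (integrable_one_add_norm_pow_mul_globalMaxwellian (E := E) 3).hasFiniteIntegral
    rw [hasFiniteIntegral_iff_enorm] at h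
    exact lt_of_le_of_lt (lintegral_mono fun w => Real.ofReal_le_enorm _) h
  refine ⟨m₃ * S, ENNReal.mul_ne_top hm₃t.ne hSt.ne, fun v => ?_⟩
  have hpt : ∀ (w : E) (ω : sphere (0 : E) 1),
      ENNReal.ofReal (hardSphereKernel (v, w) ω * globalMaxwellian w *
        ((1 + ‖w‖) / (1 + ‖v‖)) ^ 2) ≤ ENNReal.ofReal ((1 + ‖w‖) ^ 3 * globalMaxwellian w) := by
    intro w ω
    refine ENNReal.ofReal_le_ofReal ?_
    have hM := (globalMaxwellian_pos w).le
    have hB : hardSphereKernel (v, w) ω ≤ (1 + ‖v‖) * (1 + ‖w‖) := by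
      refine (hardSphereKernel_le_abs_inner_add_norm v w ω).trans ?_
      nlinarith [abs_inner_sphere_le v ω, mul_nonneg (norm_nonneg v) (norm_nonneg w)]
    have hv1 : (1 : ℝ) ≤ 1 + ‖v‖ := by linarith [norm_nonneg v]
    have hfrac : ((1 + ‖w‖) / (1 + ‖v‖)) ^ 2 ≤ (1 + ‖w‖) ^ 2 / (1 + ‖v‖) := by
      rw [div_pow, div_le_div_iff₀ (by positivity) (by positivity), pow_two (1 + ‖v‖), ← mul_assoc]
      exact mul_le_mul_of_nonneg_right (le_mul_of_one_le_right (by positivity) hv1) (by positivity)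
    calc hardSphereKernel (v, w) ω * globalMaxwellian w * ((1 + ‖w‖) / (1 + ‖v‖)) ^ 2
        ≤ (1 + ‖v‖) * (1 + ‖w‖) * globalMaxwellian w * ((1 + ‖w‖) ^ 2 / (1 + ‖v‖)) :=
          mul_le_mul (mul_le_mul_of_nonneg_right hB hM) hfrac (by positivity) (by positivity)
      _ = (1 + ‖w‖) ^ 3 * globalMaxwellian w := by
          field_simp
  calc ∫⁻ w, ∫⁻ ω, ENNReal.ofReal (hardSphereKernel (v, w) ω * globalMaxwellian w *
        ((1 + ‖w‖) / (1 + ‖v‖)) ^ 2) ∂sphereMeasure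
      ≤ ∫⁻ w, ∫⁻ _ : sphere (0 : E) 1, ENNReal.ofReal ((1 + ‖w‖) ^ 3 * globalMaxwellian w)
          ∂sphereMeasure := lintegral_mono fun w => lintegral_mono (hpt w)
    _ = m₃ * S := by
        simp only [lintegral_const]
        rw [lintegral_mul_const' _ _ hSt.ne]

/-- **Row bound for the gain weight of `g(v')`**, `w = (M(v)/M(v'))^{1/2} = e^{(|v_*|² - |v_*'|²)/4}`:
`sup_v ∫∫ ((v - v_*)·ω)₊ M(v_*) e^{(|v_*|² - |v_*'|²)/4} dω dv_* < ∞`. By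
`|v_*'|² = |v_*|² - (v_*·ω)² + (v·ω)²` the exponent is `≤ |v_*|²/4 - (v·ω)²/4`, and
`|v·ω| e^{-(v·ω)²/4} ≤ 1`. [folklore] -/
theorem exists_gainWeightFst_rowBound :
    ∃ C : ℝ≥0∞, C ≠ ∞ ∧ ∀ v : E,
      ∫⁻ w, ∫⁻ ω, ENNReal.ofReal (hardSphereKernel (v, w) ω * globalMaxwellian w *
        exp ((‖w‖ ^ 2 - ‖(collide ω (v, w)).2‖ ^ 2) / 4)) ∂sphereMeasure ≤ C := by
  haveI := isFiniteMeasure_sphereMeasure (E := E)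
  set c₀ : ℝ := (2 * π) ^ (-(finrank ℝ E : ℝ) / 2) with hc₀_def
  have hc₀ : 0 < c₀ := rpow_pos_of_pos (by positivity) _
  set S : ℝ≥0∞ := (sphereMeasure : Measure (sphere (0 : E) 1)) univ with hS
  have hSt : S < ∞ := measure_lt_top _ _
  set m₀ : ℝ≥0∞ := ∫⁻ w : E, ENNReal.ofReal (c₀ * exp (-‖w‖ ^ 2 / 4)) with hm₀
  set m₁ : ℝ≥0∞ := ∫⁻ w : E, ENNReal.ofReal (c₀ * (‖w‖ * exp (-‖w‖ ^ 2 / 4))) with hm₁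
  have hm₀t : m₀ < ∞ := lintegral_const_mul_exp_neg_norm_sq_div_four_lt_top c₀
  have hm₁t : m₁ < ∞ := lintegral_const_mul_norm_mul_exp_neg_norm_sq_div_four_lt_top hc₀.le
  refine ⟨(m₀ + m₁) * S, ENNReal.mul_ne_top (ENNReal.add_ne_top.2 ⟨hm₀t.ne, hm₁t.ne⟩) hSt.ne,
    fun v => ?_⟩
  have hpt : ∀ (w : E) (ω : sphere (0 : E) 1),
      ENNReal.ofReal (hardSphereKernel (v, w) ω * globalMaxwellian w *
        exp ((‖w‖ ^ 2 - ‖(collide ω (v, w)).2‖ ^ 2) / 4)) ≤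
      ENNReal.ofReal (c₀ * exp (-‖w‖ ^ 2 / 4)) +
        ENNReal.ofReal (c₀ * (‖w‖ * exp (-‖w‖ ^ 2 / 4))) := by
    intro w ω
    set a : ℝ := ⟪v, (ω : E)⟫_ℝ with ha
    rw [← ENNReal.ofReal_add (by positivity) (by positivity)]
    refine ENNReal.ofReal_le_ofReal ?_
    have hM := (globalMaxwellian_pos w).le
    have hB : hardSphereKernel (v, w) ω ≤ |a| + ‖w‖ := hardSphereKernel_le_abs_inner_add_norm v w ω
    have hwω : ⟪w, (ω : E)⟫_ℝ ^ 2 ≤ ‖w‖ ^ 2 := by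
      rw [← sq_abs]; exact pow_le_pow_left₀ (abs_nonneg _) (abs_inner_sphere_le w ω) 2
    have hr : exp ((‖w‖ ^ 2 - ‖(collide ω (v, w)).2‖ ^ 2) / 4) ≤
        exp (‖w‖ ^ 2 / 4) * exp (-(a ^ 2) / 4) := by
      rw [← Real.exp_add, norm_sq_collide_snd_eq]
      exact exp_le_exp.2 (by linarith)
    have hMe := globalMaxwellian_mul_exp_norm_sq_div_four w
    have h1 := abs_mul_exp_neg_sq_div_four_le_one a
    have he1 : exp (-(a ^ 2) / 4) ≤ 1 := by
      rw [exp_le_one_iff]; linarith [sq_nonneg a]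
    calc hardSphereKernel (v, w) ω * globalMaxwellian w *
          exp ((‖w‖ ^ 2 - ‖(collide ω (v, w)).2‖ ^ 2) / 4)
        ≤ (|a| + ‖w‖) * globalMaxwellian w * (exp (‖w‖ ^ 2 / 4) * exp (-(a ^ 2) / 4)) :=
          mul_le_mul (mul_le_mul_of_nonneg_right hB hM) hr (exp_pos _).le (by positivity)
      _ = (globalMaxwellian w * exp (‖w‖ ^ 2 / 4)) * (|a| * exp (-(a ^ 2) / 4)) +
            (globalMaxwellian w * exp (‖w‖ ^ 2 / 4)) * ‖w‖ * exp (-(a ^ 2) / 4) := by ring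
      _ ≤ (globalMaxwellian w * exp (‖w‖ ^ 2 / 4)) * 1 +
            (globalMaxwellian w * exp (‖w‖ ^ 2 / 4)) * ‖w‖ * 1 := by
          gcongr
      _ = c₀ * exp (-‖w‖ ^ 2 / 4) + c₀ * (‖w‖ * exp (-‖w‖ ^ 2 / 4)) := by rw [hMe]; ring
  have hmeas : Measurable fun w : E => ENNReal.ofReal (c₀ * exp (-‖w‖ ^ 2 / 4)) :=
    (by fun_prop : Continuous fun w : E => c₀ * exp (-‖w‖ ^ 2 / 4)).measurable.ennreal_ofReal
  calc ∫⁻ w, ∫⁻ ω, ENNReal.ofReal (hardSphereKernel (v, w) ω * globalMaxwellian w *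
        exp ((‖w‖ ^ 2 - ‖(collide ω (v, w)).2‖ ^ 2) / 4)) ∂sphereMeasure
      ≤ ∫⁻ w, ∫⁻ _ : sphere (0 : E) 1, (ENNReal.ofReal (c₀ * exp (-‖w‖ ^ 2 / 4)) +
          ENNReal.ofReal (c₀ * (‖w‖ * exp (-‖w‖ ^ 2 / 4)))) ∂sphereMeasure :=
        lintegral_mono fun w => lintegral_mono (hpt w)
    _ = (m₀ + m₁) * S := by
        simp only [lintegral_const]
        rw [lintegral_mul_const' _ _ hSt.ne, lintegral_add_left hmeas]

/-- **Row bound for the gain weight of `g(v_*')`**, `w = (M(v)/M(v_*'))^{1/2} = e^{(|v_*|² - |v'|²)/4}`,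
in dimension `d ≥ 2`: `sup_v ∫∫ ((v - v_*)·ω)₊ M(v_*) e^{(|v_*|² - |v'|²)/4} dω dv_* < ∞`. By
`|v'|² = |v|² - (v·ω)² + (v_*·ω)²` the exponent is `≤ |v_*|²/4 - (|v|² - (v·ω)²)/4`, so the
`dv_*`-integral is controlled by Gaussian moments and the `dω`-integral by the cap lemma
`exists_lintegral_sphere_cap_le` (this is the only place where `d ≥ 2` is used). [folklore] -/
theorem exists_gainWeightSnd_rowBound (hE : 2 ≤ finrank ℝ E) :
    ∃ C : ℝ≥0∞, C ≠ ∞ ∧ ∀ v : E,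
      ∫⁻ w, ∫⁻ ω, ENNReal.ofReal (hardSphereKernel (v, w) ω * globalMaxwellian w *
        exp ((‖w‖ ^ 2 - ‖(collide ω (v, w)).1‖ ^ 2) / 4)) ∂sphereMeasure ≤ C := by
  haveI := isFiniteMeasure_sphereMeasure (E := E)
  obtain ⟨CJ, hCJ, hJ⟩ := exists_lintegral_sphere_cap_le hE
  set c₀ : ℝ := (2 * π) ^ (-(finrank ℝ E : ℝ) / 2) with hc₀_def
  have hc₀ : 0 < c₀ := rpow_pos_of_pos (by positivity) _
  set S : ℝ≥0∞ := (sphereMeasure : Measure (sphere (0 : E) 1)) univ with hS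
  have hSt : S < ∞ := measure_lt_top _ _
  set m₀ : ℝ≥0∞ := ∫⁻ w : E, ENNReal.ofReal (c₀ * exp (-‖w‖ ^ 2 / 4)) with hm₀
  set m₁ : ℝ≥0∞ := ∫⁻ w : E, ENNReal.ofReal (c₀ * (‖w‖ * exp (-‖w‖ ^ 2 / 4))) with hm₁
  have hm₀t : m₀ < ∞ := lintegral_const_mul_exp_neg_norm_sq_div_four_lt_top c₀
  have hm₁t : m₁ < ∞ := lintegral_const_mul_norm_mul_exp_neg_norm_sq_div_four_lt_top hc₀.le
  refine ⟨m₀ * CJ + m₁ * S, ENNReal.add_ne_top.2 ⟨ENNReal.mul_ne_top hm₀t.ne hCJ,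
    ENNReal.mul_ne_top hm₁t.ne hSt.ne⟩, fun v => ?_⟩
  have hpt : ∀ (w : E) (ω : sphere (0 : E) 1),
      ENNReal.ofReal (hardSphereKernel (v, w) ω * globalMaxwellian w *
        exp ((‖w‖ ^ 2 - ‖(collide ω (v, w)).1‖ ^ 2) / 4)) ≤
      ENNReal.ofReal (c₀ * exp (-‖w‖ ^ 2 / 4)) *
          ENNReal.ofReal (|⟪v, (ω : E)⟫_ℝ| * exp (-(‖v‖ ^ 2 - ⟪v, (ω : E)⟫_ℝ ^ 2) / 4)) +
        ENNReal.ofReal (c₀ * (‖w‖ * exp (-‖w‖ ^ 2 / 4))) := by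
    intro w ω
    set a : ℝ := ⟪v, (ω : E)⟫_ℝ with ha
    rw [← ENNReal.ofReal_mul (by positivity), ← ENNReal.ofReal_add (by positivity) (by positivity)]
    refine ENNReal.ofReal_le_ofReal ?_
    have hM := (globalMaxwellian_pos w).le
    have hB : hardSphereKernel (v, w) ω ≤ |a| + ‖w‖ := hardSphereKernel_le_abs_inner_add_norm v w ω
    have hvω : a ^ 2 ≤ ‖v‖ ^ 2 := by
      rw [← sq_abs]; exact pow_le_pow_left₀ (abs_nonneg _) (abs_inner_sphere_le v ω) 2
    have hr : exp ((‖w‖ ^ 2 - ‖(collide ω (v, w)).1‖ ^ 2) / 4) ≤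
        exp (‖w‖ ^ 2 / 4) * exp (-(‖v‖ ^ 2 - a ^ 2) / 4) := by
      rw [← Real.exp_add, norm_sq_collide_fst_eq]
      exact exp_le_exp.2 (by linarith [sq_nonneg ⟪w, (ω : E)⟫_ℝ])
    have hMe := globalMaxwellian_mul_exp_norm_sq_div_four w
    have he1 : exp (-(‖v‖ ^ 2 - a ^ 2) / 4) ≤ 1 := by
      rw [exp_le_one_iff]; linarith
    calc hardSphereKernel (v, w) ω * globalMaxwellian w *
          exp ((‖w‖ ^ 2 - ‖(collide ω (v, w)).1‖ ^ 2) / 4)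
        ≤ (|a| + ‖w‖) * globalMaxwellian w * (exp (‖w‖ ^ 2 / 4) * exp (-(‖v‖ ^ 2 - a ^ 2) / 4)) :=
          mul_le_mul (mul_le_mul_of_nonneg_right hB hM) hr (exp_pos _).le (by positivity)
      _ = (globalMaxwellian w * exp (‖w‖ ^ 2 / 4)) * (|a| * exp (-(‖v‖ ^ 2 - a ^ 2) / 4)) +
            (globalMaxwellian w * exp (‖w‖ ^ 2 / 4)) * ‖w‖ * exp (-(‖v‖ ^ 2 - a ^ 2) / 4) := by
          ring
      _ ≤ (globalMaxwellian w * exp (‖w‖ ^ 2 / 4)) * (|a| * exp (-(‖v‖ ^ 2 - a ^ 2) / 4)) +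
            (globalMaxwellian w * exp (‖w‖ ^ 2 / 4)) * ‖w‖ * 1 := by
          gcongr
      _ = c₀ * exp (-‖w‖ ^ 2 / 4) * (|a| * exp (-(‖v‖ ^ 2 - a ^ 2) / 4)) +
            c₀ * (‖w‖ * exp (-‖w‖ ^ 2 / 4)) := by rw [hMe]; ring
  have hinner : ∀ w : E,
      ∫⁻ ω, ENNReal.ofReal (hardSphereKernel (v, w) ω * globalMaxwellian w *
        exp ((‖w‖ ^ 2 - ‖(collide ω (v, w)).1‖ ^ 2) / 4)) ∂sphereMeasure ≤
      ENNReal.ofReal (c₀ * exp (-‖w‖ ^ 2 / 4)) * CJ +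
        ENNReal.ofReal (c₀ * (‖w‖ * exp (-‖w‖ ^ 2 / 4))) * S := by
    intro w
    refine (lintegral_mono fun ω => hpt w ω).trans ?_
    rw [lintegral_add_right _ measurable_const, lintegral_const, ← hS,
      lintegral_const_mul' _ _ ENNReal.ofReal_ne_top]
    exact add_le_add (mul_le_mul' le_rfl (hJ v)) le_rfl
  have hmeas : Measurable fun w : E => ENNReal.ofReal (c₀ * exp (-‖w‖ ^ 2 / 4)) * CJ :=
    (by fun_prop : Continuous fun w : E => c₀ * exp (-‖w‖ ^ 2 / 4)).measurable.ennreal_ofReal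
      |>.mul_const _
  calc ∫⁻ w, ∫⁻ ω, ENNReal.ofReal (hardSphereKernel (v, w) ω * globalMaxwellian w *
        exp ((‖w‖ ^ 2 - ‖(collide ω (v, w)).1‖ ^ 2) / 4)) ∂sphereMeasure
      ≤ ∫⁻ w, (ENNReal.ofReal (c₀ * exp (-‖w‖ ^ 2 / 4)) * CJ +
          ENNReal.ofReal (c₀ * (‖w‖ * exp (-‖w‖ ^ 2 / 4))) * S) := lintegral_mono hinner
    _ = m₀ * CJ + m₁ * S := by
        rw [lintegral_add_left hmeas, lintegral_mul_const' _ _ hCJ, lintegral_mul_const' _ _ hSt.ne]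

end RowBounds

end

end Literature.Analysis.UnboundedOperators
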